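/-
Copyright (c) 2026 the pub-hodgecm-mathlib formalisation cell (harness21).  Prover seat hodgecm-mathlib-A-p19 (g26): «S3-ram» seeding wave (LEAD F0P3a-plan (g12) T11-41∕T11-52,
owner p06 (g15)), row (e2)(b) «[T2-c]-ram», layer 2 «THE MONOGENIC ORDER `𝒪[(u, λ)] ≤ 𝒪 × 𝒪[√ε]` OVER THE UNRAMIFIED EIGEN-FIELD MODEL» (road «S3-tree», crux H413).
-/
import Literature.NumberTheory.Automorphic.QuadraticRamifiedOrderMonogenic      -- ★ p846557 (this seat): `lam_sq_sub`, `mem_range_eval₂_iff`, `const_mem_range_eval₂`, `index_range_eval₂_eq_pow`, `pow_mul_mem_range_eval₂` (all `θ²`-agnostic: they never use `k₀ ∈ 𝔪`)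
import Literature.NumberTheory.Automorphic.QuadraticUnramifiedOrderUnitIndex     -- ★ (this seat, filed p846900): `isUnit_add_mul_iff_of_nonsquare`, `index_range_units_map_prod_mul_sq_eq`
import HarnessLib

/-!
# The monogenic order `R = 𝒪[x]`, `x = (u, λ)`, in `Λ = 𝒪 × O₁`, `O₁ = j𝒪 ⊕ j𝒪θ`, `θ² = jε` a NON-SQUARE UNIT: `R` local with residue field `𝓀`, `[Λ^× : R^×] = (q²−1)q^{N+n−2}`

Topic `NumberTheory/Automorphic`; namespace `Literature.NumberTheory.Automorphic`.  THEOREMS ONLY (no definition, no instance, no notation, no named fact, no `sorry`); (D0)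
currency `[Field E] [ValuativeRel E]`, abstract `O₁` with `j : 𝒪[E] →+* O₁`, `θ² = jε`, `ε̄` a non-square (`∀ b, b² − ε ∈ 𝒪^×`), unique coordinates.  The unramified twin of ★
p846557 §3–§4: there `θ² = k₀ ∈ 𝔪` (RAMIFIED eigen-field, `#𝓀_{O₁} = q`, `[Λ^× : R^×] = (q−1)q^{N+n−1}`); here the eigen-field is UNRAMIFIED (`#𝓀_{O₁} = q²`) and
**`[Λ^× : R^×] = (q² − 1)·q^{N+n−2}`** (`N + n ≥ 2`).  The data: `x = (u, λ)`, `λ = j(e₂t) + j(e₂y)·θ` a root of `X² − tX + D` (`4D = t² − y²ε`, `2e₂ = 1`), `u ≡ 1`, `t ≡ 2 (𝔪)`,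
`ord(u² − tu + D) = n`, `ord y = N ≥ 1` (the deep, unramified type-(2) datum — at a tame-RAMIFIED CM place `w` every type-(2) eigen-field is the unramified quadratic extension of
`L_w`, F0P2-p02 (g12) 21:43Z).  §2 of ★ p846557 (`[Λ : R] = q^{N+n}`, `ϖ^{N+n}Λ ⊆ R`) is `θ²`-agnostic and is CITED, not re-proved.
* `isUnit_fst_iff_isUnit_of_mem_range_of_nonsquare` — units of `R` are detected on the first coordinate (`y ∈ 𝔪` kills the `θ`-coordinate residually);
* `exists_mul_eq_one_mem_range_of_nonsquare` — `R` is inverse-closed in `Λ`;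
* `exists_isLocalRing_range_eval₂_of_nonsquare` — `R` is local with `#k_R = q` (bundled existential);
* **`index_units_range_eval₂_eq_of_nonsquare`** — `[Λ^× : R^×] = (q² − 1)·q^{N+n−2}`.
HONEST LABEL: HC_CM is proved only modulo the 2 remaining named inputs (hLiu418 24832, h413 24833) until rung 0 closes; unconditional commutative algebra, count-neutral.

## References
* [Neukirch1999] J. Neukirch, *Algebraic Number Theory* (1999): Ch. I §12 (orders, conductor, unit index).
* [SerreLocalFields1979] J.-P. Serre, *Local Fields*, GTM 67 (1979): Ch. I §6 Prop. 15–18.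
* [Rogawski1990] J. D. Rogawski, *Automorphic Representations of Unitary Groups in Three Variables* (1990): §4.9 Lemma 4.9.3 p. 56.
-/

set_option autoImplicit false

noncomputable section

open scoped ValuativeRel
open Polynomial Matrix ValuativeRel

namespace Literature.NumberTheory.Automorphic

variable {E : Type*} [Field E] [ValuativeRel E] {O₁ : Type*} [CommRing O₁] (j : 𝒪[E] →+* O₁) (θ : O₁) {k₀ : 𝒪[E]}
  (hθ : θ ^ 2 = j k₀) (hns : ∀ b : 𝒪[E], IsUnit (b * b - k₀))
  (hcoord : ∀ z : O₁, ∃! bc : 𝒪[E] × 𝒪[E], z = j bc.1 + j bc.2 * θ)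
  (u : 𝒪[E]) {t y D e₂ : 𝒪[E]} (h2 : e₂ * 2 = 1) (hD : 4 * D = t * t - y * y * k₀) {lam : O₁} (hlam : lam = j (e₂ * t) + j (e₂ * y) * θ)
  (hu1 : u - 1 ∈ IsLocalRing.maximalIdeal 𝒪[E]) (ht2 : t - 2 ∈ IsLocalRing.maximalIdeal 𝒪[E]) (hy : y ∈ IsLocalRing.maximalIdeal 𝒪[E])

/-! ## §1 Units and locality of `R = 𝒪[x]` -/

include hθ hns hcoord h2 hD hlam hu1 ht2 hy in
/-- **UNITS OF `R` ARE DETECTED ON THE FIRST COORDINATE**: for `z ∈ R = 𝒪[x]`, `z.1 ∈ 𝒪^× ↔ z ∈ Λ^×` (`u ≡ 1`, `e₂t ≡ 1`, and the `θ`-coordinate of `c₀ + c₁λ + c₂λ²` is a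
multiple of `y ∈ 𝔪`, so by ★ `isUnit_add_mul_iff_of_nonsquare` both coordinates are units iff `c₀ + c₁ + c₂` is). [cite: Neukirch1999, Ch. I §12] [cite: SerreLocalFields1979, Ch. I §6 Prop. 15] -/
theorem isUnit_fst_iff_isUnit_of_mem_range_of_nonsquare {z : 𝒪[E] × O₁}
    (hz : z ∈ (Polynomial.eval₂RingHom (RingHom.prod (RingHom.id 𝒪[E]) j) ((u, lam) : 𝒪[E] × O₁)).range) :
    IsUnit z.1 ↔ IsUnit z := by
  obtain ⟨c, rfl⟩ := (mem_range_eval₂_iff j θ hθ u h2 hD hlam z).1 hz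
  obtain ⟨hsq, -⟩ := lam_sq_sub j θ hθ h2 hD hlam
  -- the two coordinates
  set a : 𝒪[E] := c 0 + c 1 * u + c 2 * (u * u) with ha
  set b : 𝒪[E] := c 0 + c 1 * (e₂ * t) + c 2 * (e₂ * e₂ * (t * t + y * y * k₀)) with hb
  set b' : 𝒪[E] := c 1 * (e₂ * y) + c 2 * (2 * e₂ * e₂ * t * y) with hb'
  have hz1 : ((c 0, j (c 0)) + (c 1, j (c 1)) * (u, lam) + (c 2, j (c 2)) * (u, lam) ^ 2 : 𝒪[E] × O₁) = (a, j b + j b' * θ) := by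
    rw [Prod.pow_mk, hsq, hlam, ha, hb, hb']
    refine Prod.ext ?_ ?_
    · simp only [Prod.fst_add, Prod.fst_mul]; ring
    · simp only [Prod.snd_add, Prod.snd_mul, map_add, map_mul, map_ofNat]; ring
  rw [hz1, Prod.isUnit_iff]
  simp only
  rw [isUnit_add_mul_iff_of_nonsquare j θ hθ hns hcoord]
  -- `b′ ∈ 𝔪` and `a ≡ b (mod 𝔪)`
  have hb'm : b' ∈ IsLocalRing.maximalIdeal 𝒪[E] := by
    rw [hb']
    have e : c 1 * (e₂ * y) + c 2 * (2 * e₂ * e₂ * t * y) = (c 1 * e₂ + c 2 * (2 * e₂ * e₂ * t)) * y := by ring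
    rw [e]; exact Ideal.mul_mem_left _ _ hy
  have hab : a - b ∈ IsLocalRing.maximalIdeal 𝒪[E] := by
    have e1 : a - b = c 1 * (u - 1) - c 1 * e₂ * (t - 2) + c 2 * (u + 1) * (u - 1) - c 2 * e₂ * (t - 2) * (e₂ * t + 1)
        - c 2 * e₂ * e₂ * k₀ * y * y := by
      rw [ha, hb]; linear_combination (-(c 1) - c 2 * (e₂ * t + 1)) * h2
    rw [e1]
    refine Ideal.sub_mem _ (Ideal.sub_mem _ (Ideal.add_mem _ (Ideal.sub_mem _ (Ideal.mul_mem_left _ _ hu1) (Ideal.mul_mem_left _ _ ht2))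
      (Ideal.mul_mem_left _ _ hu1)) (Ideal.mul_mem_right _ _ (Ideal.mul_mem_left _ _ ht2))) (Ideal.mul_mem_right _ _ (Ideal.mul_mem_left _ _ hy))
  have key : IsUnit a ↔ IsUnit b := by
    constructor
    · intro hua
      by_contra hnb
      have hbm : b ∈ IsLocalRing.maximalIdeal 𝒪[E] := (IsLocalRing.mem_maximalIdeal _).2 hnb
      have : a ∈ IsLocalRing.maximalIdeal 𝒪[E] := by simpa using Ideal.add_mem _ hab hbm
      exact (IsLocalRing.mem_maximalIdeal _ |>.1 this) hua
    · intro hub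
      by_contra hna
      have ham : a ∈ IsLocalRing.maximalIdeal 𝒪[E] := (IsLocalRing.mem_maximalIdeal _).2 hna
      have : b ∈ IsLocalRing.maximalIdeal 𝒪[E] := by simpa using Ideal.sub_mem _ ham hab
      exact (IsLocalRing.mem_maximalIdeal _ |>.1 this) hub
  have hb'u : ¬ IsUnit b' := (IsLocalRing.mem_maximalIdeal _).1 hb'm
  constructor
  · intro hua
    exact ⟨hua, Or.inl (key.1 hua)⟩
  · rintro ⟨hua, -⟩
    exact hua

include hθ hns hcoord in
/-- **`R` IS INVERSE-CLOSED IN `Λ`**: a unit `z = (a, jb + jcθ) ∈ R` of `Λ` has an inverse IN `R` — `z` is a root of the monic cubic `(X − a)(X² − 2bX + (b² − c²ε))` whose constant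
term is a unit, so `z⁻¹ = q(z)·(p₀⁻¹, jp₀⁻¹)`. [cite: Neukirch1999, Ch. I §12] -/
theorem exists_mul_eq_one_mem_range_of_nonsquare {z : 𝒪[E] × O₁} (hzu : IsUnit z)
    (hz : z ∈ (Polynomial.eval₂RingHom (RingHom.prod (RingHom.id 𝒪[E]) j) ((u, lam) : 𝒪[E] × O₁)).range) :
    ∃ z' ∈ (Polynomial.eval₂RingHom (RingHom.prod (RingHom.id 𝒪[E]) j) ((u, lam) : 𝒪[E] × O₁)).range, z * z' = 1 := by
  set R := (Polynomial.eval₂RingHom (RingHom.prod (RingHom.id 𝒪[E]) j) ((u, lam) : 𝒪[E] × O₁)).range with hR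
  obtain ⟨⟨b, c⟩, hw, -⟩ := hcoord z.2
  simp only at hw
  have hzu' := Prod.isUnit_iff.1 hzu
  have hua : IsUnit z.1 := hzu'.1
  -- the norm `b² − c²ε` is a unit
  have hnormu : IsUnit (b * b - c * c * k₀) := by
    have h := hzu'.2
    rw [hw, isUnit_add_mul_iff_of_nonsquare j θ hθ hns hcoord] at h
    rcases h with hb | hc
    · by_cases hc : IsUnit c
      · obtain ⟨ci, hci⟩ := hc.exists_left_inv
        have hfac : b * b - c * c * k₀ = c * c * ((b * ci) * (b * ci) - k₀) := by
          have : c * ci = 1 := by rw [mul_comm]; exact hci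
          calc b * b - c * c * k₀ = b * b * (c * ci) * (c * ci) - c * c * k₀ := by rw [this, mul_one, mul_one]
            _ = c * c * ((b * ci) * (b * ci) - k₀) := by ring
        rw [hfac]; exact (hc.mul hc).mul (hns _)
      · have hcm : c * c * k₀ ∈ IsLocalRing.maximalIdeal 𝒪[E] :=
          Ideal.mul_mem_right _ _ (Ideal.mul_mem_right _ _ ((IsLocalRing.mem_maximalIdeal _).2 hc))
        by_contra hn
        have hn' : b * b - c * c * k₀ ∈ IsLocalRing.maximalIdeal 𝒪[E] := (IsLocalRing.mem_maximalIdeal _).2 hn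
        have : b * b ∈ IsLocalRing.maximalIdeal 𝒪[E] := by simpa using Ideal.add_mem _ hn' hcm
        rcases (IsLocalRing.maximalIdeal.isMaximal 𝒪[E]).isPrime.mem_or_mem this with h | h <;>
          exact ((IsLocalRing.mem_maximalIdeal _).1 h) hb
    · obtain ⟨ci, hci⟩ := hc.exists_left_inv
      have hfac : b * b - c * c * k₀ = c * c * ((b * ci) * (b * ci) - k₀) := by
        have : c * ci = 1 := by rw [mul_comm]; exact hci
        calc b * b - c * c * k₀ = b * b * (c * ci) * (c * ci) - c * c * k₀ := by rw [this, mul_one, mul_one]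
          _ = c * c * ((b * ci) * (b * ci) - k₀) := by ring
      rw [hfac]; exact (hc.mul hc).mul (hns _)
  obtain ⟨p₀, hp₀⟩ := hua.mul hnormu
  -- the cubic relation `z · q(z) = (p₀, j p₀)`
  set qz : 𝒪[E] × O₁ := z * z - ((z.1 + 2 * b, j (z.1 + 2 * b)) : 𝒪[E] × O₁) * z +
    (2 * z.1 * b + (b * b - c * c * k₀), j (2 * z.1 * b + (b * b - c * c * k₀))) with hqz
  have hrel : z * qz = ((↑p₀, j ↑p₀) : 𝒪[E] × O₁) := by
    rw [hp₀, hqz]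
    have hθ2 : θ * θ = j k₀ := by rw [← sq, hθ]
    refine Prod.ext ?_ ?_
    · simp only [Prod.fst_mul, Prod.fst_sub, Prod.fst_add]; ring
    · simp only [Prod.snd_mul, Prod.snd_sub, Prod.snd_add, map_add, map_mul, map_sub, map_ofNat]
      rw [hw]
      linear_combination (j c * j c) * ((j b + j c * θ) - j z.1) * hθ2
  have hqR : qz ∈ R := by
    rw [hqz]
    exact R.add_mem (R.sub_mem (R.mul_mem hz hz) (R.mul_mem (const_mem_range_eval₂ j u _) hz)) (const_mem_range_eval₂ j u _)
  refine ⟨qz * ((↑p₀⁻¹, j ↑p₀⁻¹) : 𝒪[E] × O₁), R.mul_mem hqR (const_mem_range_eval₂ j u _), ?_⟩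
  rw [← mul_assoc, hrel, Prod.mk_mul_mk, ← map_mul, Units.mul_inv, map_one]; rfl

include hθ hns hcoord h2 hD hlam hu1 ht2 hy in
/-- **`R = 𝒪[x]` IS A LOCAL RING WITH RESIDUE FIELD `𝓀`** (`#k_R = q`): units of `R` are read on the residue of the first coordinate, which is onto `𝓀` with kernel the
non-units.  (Bundled existential over the `IsLocalRing` instance.) [cite: Neukirch1999, Ch. I §12] -/
theorem exists_isLocalRing_range_eval₂_of_nonsquare :
    ∃ hR : IsLocalRing (Polynomial.eval₂RingHom (RingHom.prod (RingHom.id 𝒪[E]) j) ((u, lam) : 𝒪[E] × O₁)).range,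
      @Nat.card (@IsLocalRing.ResidueField (Polynomial.eval₂RingHom (RingHom.prod (RingHom.id 𝒪[E]) j) ((u, lam) : 𝒪[E] × O₁)).range _ hR) =
        Nat.card 𝓀[E] := by
  set R := (Polynomial.eval₂RingHom (RingHom.prod (RingHom.id 𝒪[E]) j) ((u, lam) : 𝒪[E] × O₁)).range with hRdef
  -- units of `R` ↔ first coordinate a unit
  have hunit : ∀ r : R, IsUnit r ↔ IsUnit (r : 𝒪[E] × O₁).1 := by
    intro r
    rw [isUnit_fst_iff_isUnit_of_mem_range_of_nonsquare j θ hθ hns hcoord u h2 hD hlam hu1 ht2 hy r.2]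
    constructor
    · intro h; exact h.map R.subtype
    · intro h
      obtain ⟨z', hz', hzz'⟩ := exists_mul_eq_one_mem_range_of_nonsquare j θ hθ hns hcoord u h r.2
      exact IsUnit.of_mul_eq_one ⟨z', hz'⟩ (Subtype.ext hzz')
  haveI : Nontrivial R := by
    refine ⟨⟨0, 1, fun h => ?_⟩⟩
    have := congrArg (fun r : R => (r : 𝒪[E] × O₁).1) h
    simp at this
  have hR : IsLocalRing R := by
    refine IsLocalRing.of_nonunits_add ?_
    intro a b ha hb
    rw [mem_nonunits_iff, hunit] at ha hb ⊢
    rw [Subring.coe_add, Prod.fst_add]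
    intro hab
    have ham : (a : 𝒪[E] × O₁).1 ∈ IsLocalRing.maximalIdeal 𝒪[E] := (IsLocalRing.mem_maximalIdeal _).2 ha
    have hbm : (b : 𝒪[E] × O₁).1 ∈ IsLocalRing.maximalIdeal 𝒪[E] := (IsLocalRing.mem_maximalIdeal _).2 hb
    exact (IsLocalRing.mem_maximalIdeal _ |>.1 (Ideal.add_mem _ ham hbm)) hab
  refine ⟨hR, ?_⟩
  letI := hR
  set χ : R →+* 𝓀[E] := (IsLocalRing.residue 𝒪[E]).comp ((RingHom.fst 𝒪[E] O₁).comp R.subtype) with hχ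
  have hχapp : ∀ r : R, χ r = IsLocalRing.residue 𝒪[E] (r : 𝒪[E] × O₁).1 := fun _ => rfl
  have hsurj : Function.Surjective χ := by
    intro x
    obtain ⟨c, rfl⟩ := IsLocalRing.residue_surjective x
    exact ⟨⟨(c, j c), const_mem_range_eval₂ j u c⟩, rfl⟩
  have hker : RingHom.ker χ = IsLocalRing.maximalIdeal R := by
    ext r
    rw [RingHom.mem_ker, hχapp, IsLocalRing.residue_eq_zero_iff, IsLocalRing.mem_maximalIdeal, IsLocalRing.mem_maximalIdeal, mem_nonunits_iff,
      mem_nonunits_iff, hunit]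
  unfold IsLocalRing.ResidueField
  rw [← hker]
  exact Nat.card_congr (RingHom.quotientKerEquivOfSurjective hsurj).toEquiv

/-! ## §2 The unit index -/

variable {ϖ : E} (hϖ : IsUniformizingElement ϖ) {n N : ℕ}
  (hn : valuation E ((u * u - t * u + D : 𝒪[E]) : E) = valuation E ϖ ^ n) (hN : valuation E ((y : 𝒪[E]) : E) = valuation E ϖ ^ N)

include hθ hns hcoord h2 hD hlam hu1 ht2 hϖ hn hN in
/-- **THE UNIT INDEX OF THE MONOGENIC ORDER `𝒪[x] ≤ 𝒪 × 𝒪[√ε]` OVER THE UNRAMIFIED EIGEN-FIELD**: with `[Λ : R] = q^{N+n}` (★ `index_range_eval₂_eq_pow`), `ϖ^{N+n}Λ ⊆ R`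
(★ `pow_mul_mem_range_eval₂`), `R` local with `#k_R = q`, `N ≥ 1`, `N + n ≥ 2`:  **`[Λ^× : R^×] = (q² − 1) · q^{N+n−2}`** (★ `index_range_units_map_prod_mul_sq_eq`).  At `𝒪 = 𝒪_w`
(`w` tame-ramified, `q = N(v)`) this is `[𝒪_A^× : 𝒪_w[δ]^×]` for the type-(2) eigen-algebra `A = L_w × M_{w₁}`, `M_{w₁} = L_w(√ε)`. [cite: Neukirch1999, Ch. I §12]
[cite: Rogawski1990, §4.9 Lemma 4.9.3 p. 56] -/
theorem index_units_range_eval₂_eq_of_nonsquare [IsDiscreteValuationRing 𝒪[E]] [Finite 𝓀[E]] (hN1 : 1 ≤ N) (hNn : 2 ≤ N + n) :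
    (Units.map ((Polynomial.eval₂RingHom (RingHom.prod (RingHom.id 𝒪[E]) j) ((u, lam) : 𝒪[E] × O₁)).range.subtype :
        (Polynomial.eval₂RingHom (RingHom.prod (RingHom.id 𝒪[E]) j) ((u, lam) : 𝒪[E] × O₁)).range →* 𝒪[E] × O₁)).range.index =
      (Nat.card 𝓀[E] ^ 2 - 1) * Nat.card 𝓀[E] ^ (N + n - 2) := by
  set R := (Polynomial.eval₂RingHom (RingHom.prod (RingHom.id 𝒪[E]) j) ((u, lam) : 𝒪[E] × O₁)).range with hR
  -- `y ∈ 𝔪` from `|y| = |ϖ|^N`, `N ≥ 1`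
  have hy : y ∈ IsLocalRing.maximalIdeal 𝒪[E] := by
    rw [IsLocalRing.mem_maximalIdeal, mem_nonunits_iff, Valuation.Integers.isUnit_iff_valuation_eq_one (Valuation.integer.integers (valuation E))]
    change ¬ valuation E ((y : 𝒪[E]) : E) = 1
    rw [hN]
    have hlt : valuation E ϖ ^ N < 1 := pow_lt_one₀ zero_le hϖ.valuation_lt_one (by omega)
    exact hlt.ne
  obtain ⟨hRloc, hres⟩ := exists_isLocalRing_range_eval₂_of_nonsquare j θ hθ hns hcoord u h2 hD hlam hu1 ht2 hy
  letI := hRloc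
  have hq : 1 < Nat.card 𝓀[E] := Finite.one_lt_card
  have hcond := pow_mul_mem_range_eval₂ j θ hθ hcoord u h2 hD hlam hϖ hn hN
  have hidx := index_range_eval₂_eq_pow j θ hθ hcoord u h2 hD hlam hϖ hn hN
  have key := index_range_units_map_prod_mul_sq_eq j θ hθ hns hcoord hϖ (by omega : 0 < N + n) R hres hcond
  rw [hidx] at key
  have hpow : Nat.card 𝓀[E] ^ (N + n) = Nat.card 𝓀[E] ^ (N + n - 2) * Nat.card 𝓀[E] ^ 2 := by
    rw [← pow_add, Nat.sub_add_cancel hNn]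
  rw [hpow, ← mul_assoc] at key
  exact Nat.eq_of_mul_eq_mul_right (by positivity) key

end Literature.NumberTheory.Automorphic

end
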